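import Mathlib
import HarnessLib
import Summits.HubbardSuperconductivity.HubbardSuperconductivity.Theorems.KLProgrammeKLRegimeSplitBundleV7
import Summits.HubbardSuperconductivity.HubbardSuperconductivity.Theorems.KLProgrammeKLRegimeSplitGenericV2

/-!
# Route `KLProgramme` — child 2 of the K3 resplit, `CountertermP2 klPredsV7 klWindowC` (route decl `KLRegimeCountertermV7` once filed):
# REDUCTION TO THE ONE-VOLUME CONSTRUCTION — the volume transfer by (E3f) PROVED (crux K3 stmt-HubbardSuperconductivity-19937; seat p2 g4)

Child 2 = one admissible frame `K`, chosen before the volume, renormalised (`RenormalisedAtF`, quadratic tolerance) at every scale and every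
large volume.  This module fixes child 2's renormalisation package as a function of `G` alone (`ctRen G = ⟨5·S₀+1, 1, S_j+1⟩`, Δ8),
names child 2's hypothesis block `CtHypV7`, and PROVES the volume half (Δ14's consumption, p1b's route): if `K` is renormalised to HALF
tolerance at ONE construction volume `(L₀, M₀)` with `Q.CL β n / L₀` inside the other half, then `K` is renormalised at EVERY volume
`L ≥ L₀`, `M ≥ max (Mh L) (Q.M0 β L)` — by strong induction on the scale at the target volume: the renormalisation below `n` there plus the
hypothesis block give the V7 history `histV7 ∧ TwoLegStepG` below `n` (the (E3f) antecedent), and (E3f) AT THE CONSTRUCTION VOLUME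
compares the two local parts (`ct_volumeTransfer`).  Hence `CountertermP2 klPredsV7 klWindowC` follows from the ONE-VOLUME CONSTRUCTION
`CtOneVolume` alone (`countertermP2_klPredsV7_of`) — the stage scheme with frozen coarse pieces (`frameOK_of_pieces`), child 2's remaining
analytic content.  Proofs + two definitions; nothing is asserted about the model.
-/

noncomputable section

namespace Summit.HubbardSuperconductivity.HubbardSuperconductivity.Theorems.KLRegimeSplit

set_option linter.dupNamespace false

open Real Finset Literature.MathematicalPhysics.QuantumLattice Literature.Probability.LatticeModels
open Summit.HubbardSuperconductivity.HubbardSuperconductivity.Theorems.KLProgrammeLegKernels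

/-- Child 2's mismatch tolerance from the absolute two-leg size `G.S 0` (tail `≈ 2.2 S₀` + stage-ball slack `≈ 2 S₀` + 1). -/
def ctCr (G : GeoConsts) : ℝ := 5 * G.S 0 + 1

/-- Child 2's renormalisation package, a function of `G` alone (Δ8: chosen before `Q`): `cr = ctCr G`, `cz = 1`, `Gfr j = G.S j + 1`. -/
def ctRen (G : GeoConsts) : RenConsts := ⟨ctCr G, 1, fun j => G.S j + 1⟩

/-- `ctRen G` is well formed with positive tolerances when `G` is. -/
theorem ctRen_WF2 {G : GeoConsts} (hG : G.WF) : (ctRen G).WF2 := by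
  have hS : ∀ j, 0 ≤ G.S j := hG.2.2.2.2.2.2.2.2.2.2.2.2.2.2.2.2.2.1
  refine ⟨⟨?_, ?_, ?_⟩, ?_, ?_⟩
  · show 0 ≤ ctCr G; unfold ctCr; nlinarith [hS 0]
  · show (0 : ℝ) ≤ 1; norm_num
  · intro j; show 0 ≤ G.S j + 1; linarith [hS j]
  · show 0 < ctCr G; unfold ctCr; nlinarith [hS 0]
  · show (0 : ℝ) < 1; norm_num

section Model

/-- **Child 2's hypothesis block** at `(G, P, Q, β, U, μ)` beyond thresholds `(Lh, Mh)` for the V7 bundle: every admissible frame, at every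
large volume and every scale, renormalised below the scale ⇒ engine output, two-leg step and split at the scale. -/
def CtHypV7 (G : GeoConsts) (P : SplitConsts) (Q : EngConsts) (β U μ : ℝ) (Lh : ℕ) (Mh : ℕ → ℕ) : Prop :=
  ∀ K : TrigPolyC4v, FrameOK (ctRen G) U (nScales β) μ K →
    ∀ (L M : ℕ) [NeZero L] [NeZero M], Lh ≤ L → Mh L ≤ M →
      ∀ n : ℕ, n ≤ nScales β → (∀ j < n, RenormalisedAtF L M β U μ K (ctRen G) j) →
        EngineBoundsAtV5S L M G P Q β U μ K n ∧ TwoLegStepV7 L M G P Q (ctRen G) β U μ K n ∧ BetaSplitAtS2 L M G P Q β U μ K n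

end Model

/-- **The ONE-VOLUME CONSTRUCTION** (the remaining stub of child 2; stage scheme with frozen coarse pieces).  For the constants
`(G, P, Q)`: there are `c₁, U₀` such that, in the regime, from the hypothesis block beyond `(Lh, Mh)` one builds at ONE volume
`(L₀, M₀) ≥ (Lh, Mh L₀)`, `M₀ ≥ Q.M0 β L₀`, an ADMISSIBLE frame `K` (each stage's piece certified once: `frameOK_of_pieces`) whose local
parts at `(L₀, M₀)` are within HALF the quadratic tolerance at every scale, with `L₀` so large that the volume rate `Q.CL β n / L₀` fits in
the other half (finite max over `n ≤ n_β`). -/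
def CtOneVolume (G : GeoConsts) (P : SplitConsts) (Q : EngConsts) : Prop :=
    ∃ c₁ : ℝ, 0 < c₁ ∧ ∀ c : ℝ, 0 < c → c ≤ c₁ → ∃ U₀ : ℝ, 0 < U₀ ∧
      ∀ μ ∈ klWindowC, ∀ U : ℝ, 0 < U → U ≤ U₀ → ∀ β : ℝ, klBetaMin ≤ β → β ≤ Real.exp (c / U ^ 2) →
        ∀ (Lh : ℕ) (Mh : ℕ → ℕ), CtHypV7 G P Q β U μ Lh Mh →
          ∃ K : TrigPolyC4v, FrameOK (ctRen G) U (nScales β) μ K ∧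
            ∃ (L₀ M₀ : ℕ), 0 < L₀ ∧ 0 < M₀ ∧ Lh ≤ L₀ ∧ Mh L₀ ≤ M₀ ∧ Q.M0 β L₀ ≤ M₀ ∧
              (∀ (_ : NeZero L₀) (_ : NeZero M₀), ∀ n : ℕ, n ≤ nScales β →
                (∀ θ : ℝ, |klLocalPart L₀ M₀ β U μ K n θ| ≤ ctCr G * |U| * klScale klE0 n ^ 2 / klE0 / 2) ∧
                Q.CL β n / L₀ ≤ ctCr G * |U| * klScale klE0 n ^ 2 / klE0 / 2)

/-- **VOLUME TRANSFER (PROVED; p1b 13:5x/14:08Z (iii) route).**  From the one-volume frame of STUB 1 and the hypothesis block: at every volume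
`(L, M)` with `L₀ ≤ L`, `max (Mh L) (Q.M0 β L) ≤ M`, upward induction on `n` — the renormalisation of `K` at `(L, M)` below `n` gives the
V7 history there (`histRate_of_histP`-type), which is (E3f)'s antecedent at the construction volume `(L₀, M₀)`; so
`|ν_n^{L,M}| ≤ ½tol + Q.CL β n / L₀ ≤ tol`. -/
theorem ct_volumeTransfer (G : GeoConsts) (P : SplitConsts) (Q : EngConsts) (hG : G.WF) {β U μ : ℝ} {Lh : ℕ} {Mh : ℕ → ℕ}
    (hyp : CtHypV7 G P Q β U μ Lh Mh) {K : TrigPolyC4v} (hK : FrameOK (ctRen G) U (nScales β) μ K) {L₀ M₀ : ℕ} [NeZero L₀] [NeZero M₀]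
    (hL₀ : Lh ≤ L₀) (hM₀ : Mh L₀ ≤ M₀) (hM₀' : Q.M0 β L₀ ≤ M₀)
    (hhalf : ∀ n : ℕ, n ≤ nScales β →
      (∀ θ : ℝ, |klLocalPart L₀ M₀ β U μ K n θ| ≤ ctCr G * |U| * klScale klE0 n ^ 2 / klE0 / 2) ∧
      Q.CL β n / L₀ ≤ ctCr G * |U| * klScale klE0 n ^ 2 / klE0 / 2) :
    ∀ (L M : ℕ) [NeZero L] [NeZero M], L₀ ≤ L → max (Mh L) (Q.M0 β L) ≤ M →
      ∀ n : ℕ, n ≤ nScales β → RenormalisedAtF L M β U μ K (ctRen G) n := by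
  have _ := hG
  -- renormalisation at the construction volume, at every scale (half tolerance ≤ tolerance)
  have htol_nonneg : ∀ n, 0 ≤ ctCr G * |U| * klScale klE0 n ^ 2 / klE0 / 2 := by
    intro n
    have hS : ∀ j, 0 ≤ G.S j := hG.2.2.2.2.2.2.2.2.2.2.2.2.2.2.2.2.2.1
    have hcr : 0 ≤ ctCr G := by unfold ctCr; nlinarith [hS 0]
    have he0 : (0:ℝ) < klE0 := by norm_num [klE0]
    positivity
  have hren0 : ∀ n, n ≤ nScales β → RenormalisedAtF L₀ M₀ β U μ K (ctRen G) n := by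
    intro n hn θ
    have h := (hhalf n hn).1 θ
    show |klLocalPart L₀ M₀ β U μ K n θ| ≤ ctCr G * |U| * klScale klE0 n ^ 2 / klE0
    linarith [htol_nonneg n]
  intro L M _ _ hL hM
  have hMh : Mh L ≤ M := (le_max_left _ _).trans hM
  have hM0 : Q.M0 β L ≤ M := (le_max_right _ _).trans hM
  have hLh : Lh ≤ L := hL₀.trans hL
  -- strong induction on the scale at the target volume
  intro n
  induction n using Nat.strong_induction_on with
  | _ n ih =>
    intro hn θ
    -- history at the target volume below `n`
    have hrenL : ∀ j < n, RenormalisedAtF L M β U μ K (ctRen G) j := fun j hj =>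
      ih j hj (le_of_lt (lt_of_lt_of_le hj hn))
    have hslotsL : ∀ j < n, EngineBoundsAtV5S L M G P Q β U μ K j ∧ TwoLegStepV7 L M G P Q (ctRen G) β U μ K j ∧
        BetaSplitAtS2 L M G P Q β U μ K j := fun j hj =>
      hyp K hK L M hLh hMh j (le_of_lt (lt_of_lt_of_le hj hn)) fun i hi => hrenL i (hi.trans hj)
    have hanteL : ∀ j < n, histV7 L M G P Q (ctRen G) β U μ K j ∧
        TwoLegStepG L M (histV7 L M G P Q (ctRen G) β U μ) G P Q (ctRen G) β U μ K j := fun j hj =>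
      ⟨⟨(hslotsL j hj).2.2, hrenL j hj, (hslotsL j hj).1⟩, (hslotsL j hj).2.1.1⟩
    -- the two-leg step at the construction volume at scale `n`, hence its volume-rate clause
    have hstep0 : TwoLegStepV7 L₀ M₀ G P Q (ctRen G) β U μ K n :=
      (hyp K hK L₀ M₀ hL₀ hM₀ n hn fun j hj => hren0 j (le_of_lt (lt_of_lt_of_le hj hn))).2.1
    have hrate := hstep0.2 hM₀' L M hL hM0 hanteL θ
    have hhalfθ := (hhalf n hn).1 θ
    have hCL := (hhalf n hn).2
    show |klLocalPart L M β U μ K n θ| ≤ ctCr G * |U| * klScale klE0 n ^ 2 / klE0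
    have htri : |klLocalPart L M β U μ K n θ| ≤
        |klLocalPart L₀ M₀ β U μ K n θ| + |klLocalPart L₀ M₀ β U μ K n θ - klLocalPart L M β U μ K n θ| := by
      have h1 := abs_sub_abs_le_abs_sub (klLocalPart L M β U μ K n θ) (klLocalPart L₀ M₀ β U μ K n θ)
      rw [abs_sub_comm] at h1
      linarith
    linarith

/-- **COMPOSITION: child 2 of the K3 resplit at the bundle of record follows from the one-volume construction alone**
(`CtOneVolume` for all well-formed constants) — the volume transfer is proved above. -/
theorem countertermP2_klPredsV7_of (hone : ∀ G P Q, G.WF → P.WF → Q.WF → CtOneVolume G P Q) :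
    CountertermP2 klPredsV7 klWindowC := by
  intro G P hG hP
  refine ⟨ctRen G, ctRen_WF2 hG, fun Q hQ => ?_⟩
  obtain ⟨c₁, hc₁, hc⟩ := hone G P Q hG hP hQ
  refine ⟨c₁, hc₁, fun c hc0 hcc => ?_⟩
  obtain ⟨U₀, hU₀, hmain⟩ := hc c hc0 hcc
  refine ⟨U₀, hU₀, fun μ hμ U hU hUle β hβ hβc Lh Mh hhyp => ?_⟩
  have hyp : CtHypV7 G P Q β U μ Lh Mh := fun K hK L M _ _ hL hM n hn hren =>
    hhyp K hK L M hL hM n hn hren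
  obtain ⟨K, hK, L₀, M₀, hL₀pos, hM₀pos, hL₀, hM₀, hM₀', hhalf⟩ := hmain μ hμ U hU hUle β hβ hβc Lh Mh hyp
  haveI : NeZero L₀ := ⟨Nat.pos_iff_ne_zero.mp hL₀pos⟩
  haveI : NeZero M₀ := ⟨Nat.pos_iff_ne_zero.mp hM₀pos⟩
  refine ⟨K, hK, L₀, fun L => max (Mh L) (Q.M0 β L), fun L M _ _ hL hM n hn => ?_⟩
  exact ct_volumeTransfer G P Q hG hyp hK hL₀ hM₀ hM₀' (hhalf inferInstance inferInstance) L M hL hM n hn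

end Summit.HubbardSuperconductivity.HubbardSuperconductivity.Theorems.KLRegimeSplit

end
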